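import Literature.Geometry.Lorentzian.CausalityAchronalProofs
import Literature.Geometry.Lorentzian.LorentzianMetricProofs
import Literature.Geometry.Lorentzian.HypersurfaceRestriction
import HarnessLib

/-!
# Causal curves in open sub-spacetimes; a common Cauchy hypersurface of an open cover is a Cauchy
# hypersurface of the union (Sbierski 2016, §3.1, proof of the existence of the MCGHD)

Second ingredient (after `CauchyDevelopmentRestrict`, the sub-developments `U ⊆ M`) of the
construction of the maximal common globally hyperbolic development as the **union of all common
globally hyperbolic developments** (Sbierski, Ann. Henri Poincaré 17 (2016) = arXiv:1309.7591,
§3.1, proof of the theorem "Existence of MCGHD", second bullet):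

> *"`U` is globally hyperbolic with Cauchy surface `ι(M̄)`: Let `γ` be an inextendible timelike
> curve in `U`. Take a point on `γ`; it lies in some `U_α` and the corresponding curve segment in
> `U_α` can be considered to be an inextendible timelike curve in `U_α` and thus has to meet
> `ι(M̄)`. Note that `γ` cannot meet `ι(M̄)` more than once, since `γ` is also a segment of an
> inextendible timelike curve in `M` — and `M` is globally hyperbolic."*

over the corrected causality notions of `Causality.lean` (`IsEndlessTimelikeCurve`,
`IsCauchyHypersurface`) and the restricted structures `LorentzianMetric.restrict`,
`TimeOrientation.restrict` of an open sub-spacetime: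

* `hasFutureEndpoint_subtypeVal_comp_iff`, `IsFutureEndless.of_subtypeVal_comp` (and past
  versions) — endpoints and endlessness along the inclusion of a subspace;
* `not_hasFutureEndpoint_connectedComponentIn`, `not_hasPastEndpoint_connectedComponentIn` —
  **the "corresponding curve segment"**: the connected piece through a chosen parameter of an
  endless curve inside an open subset has no endpoint in that subset (pure topology: either the
  piece is a final segment, or it ends at a parameter whose image lies outside the subset, and
  limits are unique);
* `velocity_subtypeVal_comp`, `isFutureTimelikeCurveOn_restrict_iff`,
  `IsEndlessTimelikeCurve.restrict_of_subtypeVal_comp` — timelike curves of an open sub-spacetime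
  are the timelike curves of the ambient spacetime lying in it (`T_p U = T_p M`);
* `IsCauchyHypersurface.eq_of_mem_of_mem_opens` — **at most one crossing**: a timelike curve of any
  open sub-spacetime meets a Cauchy hypersurface of `M` at most once
  (`exists_isEndlessTimelikeCurve_extends` of `CausalityAchronalProofs`);
* `IsCauchyHypersurface.iSup_opens` — **the displayed statement**: if `S` is a Cauchy hypersurface
  of `M` and of each open sub-spacetime `V i`, it is a Cauchy hypersurface of `⨆ i, V i`.

All results proved; no definitions, no named facts. Standing hypotheses of the two Cauchy
statements: Hausdorff, second countable, boundaryless, finite-dimensional, `C²` metric (those of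
`exists_isEndlessTimelikeCurve_extends`).

## References

* J. Sbierski, *On the existence of a maximal Cauchy development for the Einstein equations: a
  dezornification*, Ann. Henri Poincaré 17 (2016) 301–329 = arXiv:1309.7591, §3.1 (proof of the
  existence of the MCGHD).
* B. O'Neill, *Semi-Riemannian geometry with applications to relativity*, 1983, Ch. 14,
  Def. 14.28 and Lemma 14.29 (Cauchy hypersurfaces are achronal), Ch. 1, pp. 3–7 (open
  submanifolds).
* S. W. Hawking, G. F. R. Ellis, *The large scale structure of space-time*, 1973, §6.2 (endpoints).
-/

noncomputable section

open Bundle Set Function Filter TopologicalSpace Topology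
open scoped Manifold ContDiff Topology

namespace Literature.Geometry.Lorentzian

/-! ### Topology of endpoints along a subspace -/

section Topology

variable {M : Type*} [TopologicalSpace M]

/-- A future endpoint in a subspace is a future endpoint in the ambient space (and conversely for
limits in the subspace): the inclusion is inducing. [folklore] -/
theorem hasFutureEndpoint_subtypeVal_comp_iff {O : Set M} {γ : ℝ → O} {s : Set ℝ} {p : O} :
    HasFutureEndpoint (Subtype.val ∘ γ) s (p : M) ↔ HasFutureEndpoint γ s p :=
  (Topology.IsInducing.subtypeVal.tendsto_nhds_iff (f := fun t : s ↦ γ t)).symm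

/-- Past version of `hasFutureEndpoint_subtypeVal_comp_iff`. [folklore] -/
theorem hasPastEndpoint_subtypeVal_comp_iff {O : Set M} {γ : ℝ → O} {s : Set ℝ} {p : O} :
    HasPastEndpoint (Subtype.val ∘ γ) s (p : M) ↔ HasPastEndpoint γ s p :=
  (Topology.IsInducing.subtypeVal.tendsto_nhds_iff (f := fun t : s ↦ γ t)).symm

/-- A curve in a subspace which is future endless in the ambient space is future endless in the
subspace. [folklore] -/
theorem IsFutureEndless.of_subtypeVal_comp {O : Set M} {γ : ℝ → O} {s : Set ℝ}
    (h : IsFutureEndless (Subtype.val ∘ γ) s) : IsFutureEndless γ s :=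
  ⟨h.1, fun p hp ↦ h.2 p (hasFutureEndpoint_subtypeVal_comp_iff.2 hp)⟩

/-- A curve in a subspace which is past endless in the ambient space is past endless in the
subspace. [folklore] -/
theorem IsPastEndless.of_subtypeVal_comp {O : Set M} {γ : ℝ → O} {s : Set ℝ}
    (h : IsPastEndless (Subtype.val ∘ γ) s) : IsPastEndless γ s :=
  ⟨h.1, fun p hp ↦ h.2 p (hasPastEndpoint_subtypeVal_comp_iff.2 hp)⟩

/-- **Endlessness passes to the connected piece inside an open subset (future direction).** Let
`γ : ℝ → M` be continuous at every point of the interval `s`, future endless on `s`, and let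
`O ⊆ M` be open with `γ t₀ ∈ O`, `t₀ ∈ s`. Let `J` be the connected component of `t₀` in
`{t ∈ s | γ t ∈ O}`. Then `γ|_J` has no future endpoint in `O`: either `J` contains all of `s`
beyond `t₀` (and an endpoint of `γ|_J` would be one of `γ`), or `J` ends at a parameter
`b* ∈ s` with `γ b* ∉ O`, and `γ t → γ b*` along `J`, so that a limit in `O` is excluded by
uniqueness of limits. This is the observation "the corresponding curve segment in `U_α` can be
considered to be an inextendible timelike curve in `U_α`" in Sbierski's proof of the existence of
the MCGHD (2016, §3.1). [cite: Sbierski2016AHP, §3.1, proof of the existence of the MCGHD] -/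
theorem not_hasFutureEndpoint_connectedComponentIn [T2Space M] {γ : ℝ → M} {s : Set ℝ}
    (hs : s.OrdConnected) (hcont : ∀ t ∈ s, ContinuousAt γ t) (hend : IsFutureEndless γ s)
    {O : Set M} (hO : IsOpen O) {t₀ : ℝ} (ht₀ : t₀ ∈ s) (hγt₀ : γ t₀ ∈ O) {p : M} (hp : p ∈ O) :
    ¬ HasFutureEndpoint γ (connectedComponentIn (s ∩ γ ⁻¹' O) t₀) p := by
  set J := connectedComponentIn (s ∩ γ ⁻¹' O) t₀ with hJ
  have ht₀J : t₀ ∈ J := mem_connectedComponentIn ⟨ht₀, hγt₀⟩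
  have hJsub : J ⊆ s ∩ γ ⁻¹' O := connectedComponentIn_subset _ _
  have hJord : J.OrdConnected :=
    (isPreconnected_iff_ordConnected.1 isPreconnected_connectedComponentIn)
  intro hpJ
  by_cases hA : ∀ t ∈ s, t₀ ≤ t → t ∈ J
  · -- Case A: `J` is a final segment of `s`; then `p` is a future endpoint of `γ` itself
    have h := (hasFutureEndpoint_congr_set (γ := γ) ht₀J ht₀
      (fun t ht ↦ ⟨fun htJ ↦ (hJsub htJ).1, fun hts ↦ hA t hts ht⟩) p).1 hpJ
    exact hend.2 p h
  · -- Case B: `J` ends at `b* = sup J ∈ s` with `γ b* ∉ O`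
    push Not at hA
    obtain ⟨b', hb's, ht₀b', hb'J⟩ := hA
    have hJlt : ∀ t ∈ J, t < b' := fun t htJ ↦ by
      by_contra h
      exact hb'J (hJord.out ht₀J htJ ⟨ht₀b', not_lt.1 h⟩)
    have hJbdd : BddAbove J := ⟨b', fun t ht ↦ (hJlt t ht).le⟩
    have hJne : J.Nonempty := ⟨t₀, ht₀J⟩
    set b := sSup J with hb
    have ht₀b : t₀ ≤ b := le_csSup hJbdd ht₀J
    have hbb' : b ≤ b' := csSup_le hJne fun t ht ↦ (hJlt t ht).le
    have hbs : b ∈ s := hs.out ht₀ hb's ⟨ht₀b, hbb'⟩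
    -- `γ b ∉ O`
    have hγb : γ b ∉ O := by
      intro hγbO
      -- a parameter neighbourhood of `b` within `s` is mapped into `O`
      have hnhds : γ ⁻¹' O ∈ 𝓝 b := (hcont b hbs).preimage_mem_nhds (hO.mem_nhds hγbO)
      obtain ⟨ε, hε, hball⟩ := Metric.mem_nhds_iff.1 hnhds
      -- the piece `K = B(b, ε) ∩ s` lies in the component `J`
      set K : Set ℝ := Metric.ball b ε ∩ s with hK
      have hKsub : K ⊆ s ∩ γ ⁻¹' O := fun t ht ↦ ⟨ht.2, hball ht.1⟩
      have hKconn : IsPreconnected K := by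
        rw [hK, Real.ball_eq_Ioo]
        exact (isPreconnected_iff_ordConnected.2 (ordConnected_Ioo.inter hs))
      obtain ⟨t₁, ht₁J, ht₁⟩ : ∃ t₁ ∈ J, b - ε < t₁ := exists_lt_of_lt_csSup hJne (by linarith)
      have ht₁K : t₁ ∈ K := by
        refine ⟨?_, (hJsub ht₁J).1⟩
        rw [Real.ball_eq_Ioo]
        exact ⟨ht₁, (le_csSup hJbdd ht₁J).trans_lt (by linarith)⟩
      have hJK : J ∪ K ⊆ J := by
        have hpre : IsPreconnected (J ∪ K) :=
          isPreconnected_connectedComponentIn.union t₁ ht₁J ht₁K hKconn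
        exact hpre.subset_connectedComponentIn (Or.inl ht₀J) (union_subset hJsub hKsub)
      -- a parameter of `s` beyond `b` inside the ball: contradiction with `b = sup J`
      rcases eq_or_lt_of_le hbb' with hbeq | hblt
      · exact hb'J (hJK (Or.inr ⟨by rw [Real.ball_eq_Ioo, ← hbeq]; exact ⟨by linarith, by linarith⟩,
          hb's⟩))
      · set t₂ := min b' (b + ε / 2) with ht₂
        have ht₂s : t₂ ∈ s := hs.out hbs hb's ⟨le_min hblt.le (by linarith), min_le_left _ _⟩
        have ht₂b : b < t₂ := lt_min hblt (by linarith)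
        have ht₂K : t₂ ∈ K := by
          refine ⟨?_, ht₂s⟩
          rw [Real.ball_eq_Ioo]
          exact ⟨by linarith, (min_le_right _ _).trans_lt (by linarith)⟩
        have := le_csSup hJbdd (hJK (Or.inr ht₂K))
        linarith
    -- `γ t → γ b` along `J`
    have hbJ : b ∉ J := fun h ↦ hγb (hJsub h).2
    haveI : Nonempty J := ⟨⟨t₀, ht₀J⟩⟩
    have hcoe : Tendsto (fun t : J ↦ (t : ℝ)) atTop (𝓝 b) :=
      tendsto_atTop_isLUB (fun _ _ h ↦ h) (by rw [Subtype.range_coe]; exact isLUB_csSup hJne hJbdd)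
    have hlim : Tendsto (fun t : J ↦ γ t) atTop (𝓝 (γ b)) := (hcont b hbs).tendsto.comp hcoe
    -- uniqueness of limits
    have hpb : p = γ b := tendsto_nhds_unique hpJ hlim
    exact hγb (hpb ▸ hp)

/-- **Endlessness passes to the connected piece inside an open subset (past direction)**, the
time dual of `not_hasFutureEndpoint_connectedComponentIn`.
[cite: Sbierski2016AHP, §3.1, proof of the existence of the MCGHD] -/
theorem not_hasPastEndpoint_connectedComponentIn [T2Space M] {γ : ℝ → M} {s : Set ℝ}
    (hs : s.OrdConnected) (hcont : ∀ t ∈ s, ContinuousAt γ t) (hend : IsPastEndless γ s)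
    {O : Set M} (hO : IsOpen O) {t₀ : ℝ} (ht₀ : t₀ ∈ s) (hγt₀ : γ t₀ ∈ O) {p : M} (hp : p ∈ O) :
    ¬ HasPastEndpoint γ (connectedComponentIn (s ∩ γ ⁻¹' O) t₀) p := by
  set J := connectedComponentIn (s ∩ γ ⁻¹' O) t₀ with hJ
  have ht₀J : t₀ ∈ J := mem_connectedComponentIn ⟨ht₀, hγt₀⟩
  have hJsub : J ⊆ s ∩ γ ⁻¹' O := connectedComponentIn_subset _ _
  have hJord : J.OrdConnected :=
    (isPreconnected_iff_ordConnected.1 isPreconnected_connectedComponentIn)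
  intro hpJ
  by_cases hA : ∀ t ∈ s, t ≤ t₀ → t ∈ J
  · have h := (hasPastEndpoint_congr_set (γ := γ) ht₀J ht₀
      (fun t ht ↦ ⟨fun htJ ↦ (hJsub htJ).1, fun hts ↦ hA t hts ht⟩) p).1 hpJ
    exact hend.2 p h
  · push Not at hA
    obtain ⟨b', hb's, hb't₀, hb'J⟩ := hA
    have hJgt : ∀ t ∈ J, b' < t := fun t htJ ↦ by
      by_contra h
      exact hb'J (hJord.out htJ ht₀J ⟨not_lt.1 h, hb't₀⟩)
    have hJbdd : BddBelow J := ⟨b', fun t ht ↦ (hJgt t ht).le⟩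
    have hJne : J.Nonempty := ⟨t₀, ht₀J⟩
    set b := sInf J with hb
    have hbt₀ : b ≤ t₀ := csInf_le hJbdd ht₀J
    have hb'b : b' ≤ b := le_csInf hJne fun t ht ↦ (hJgt t ht).le
    have hbs : b ∈ s := hs.out hb's ht₀ ⟨hb'b, hbt₀⟩
    have hγb : γ b ∉ O := by
      intro hγbO
      have hnhds : γ ⁻¹' O ∈ 𝓝 b := (hcont b hbs).preimage_mem_nhds (hO.mem_nhds hγbO)
      obtain ⟨ε, hε, hball⟩ := Metric.mem_nhds_iff.1 hnhds
      set K : Set ℝ := Metric.ball b ε ∩ s with hK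
      have hKsub : K ⊆ s ∩ γ ⁻¹' O := fun t ht ↦ ⟨ht.2, hball ht.1⟩
      have hKconn : IsPreconnected K := by
        rw [hK, Real.ball_eq_Ioo]
        exact (isPreconnected_iff_ordConnected.2 (ordConnected_Ioo.inter hs))
      obtain ⟨t₁, ht₁J, ht₁⟩ : ∃ t₁ ∈ J, t₁ < b + ε := exists_lt_of_csInf_lt hJne (by linarith)
      have ht₁K : t₁ ∈ K := by
        refine ⟨?_, (hJsub ht₁J).1⟩
        rw [Real.ball_eq_Ioo]
        exact ⟨(by linarith : b - ε < b).trans_le (csInf_le hJbdd ht₁J), ht₁⟩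
      have hJK : J ∪ K ⊆ J := by
        have hpre : IsPreconnected (J ∪ K) :=
          isPreconnected_connectedComponentIn.union t₁ ht₁J ht₁K hKconn
        exact hpre.subset_connectedComponentIn (Or.inl ht₀J) (union_subset hJsub hKsub)
      rcases eq_or_lt_of_le hb'b with hbeq | hblt
      · exact hb'J (hJK (Or.inr ⟨by rw [Real.ball_eq_Ioo, hbeq]; exact ⟨by linarith, by linarith⟩,
          hb's⟩))
      · set t₂ := max b' (b - ε / 2) with ht₂
        have ht₂s : t₂ ∈ s := hs.out hb's hbs ⟨le_max_left _ _, max_le hblt.le (by linarith)⟩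
        have ht₂b : t₂ < b := max_lt hblt (by linarith)
        have ht₂K : t₂ ∈ K := by
          refine ⟨?_, ht₂s⟩
          rw [Real.ball_eq_Ioo]
          exact ⟨(by linarith : b - ε < b - ε / 2).trans_le (le_max_right _ _), by linarith⟩
        have := csInf_le hJbdd (hJK (Or.inr ht₂K))
        linarith
    have hbJ : b ∉ J := fun h ↦ hγb (hJsub h).2
    haveI : Nonempty J := ⟨⟨t₀, ht₀J⟩⟩
    have hcoe : Tendsto (fun t : J ↦ (t : ℝ)) atBot (𝓝 b) :=
      tendsto_atBot_isGLB (fun _ _ h ↦ h) (by rw [Subtype.range_coe]; exact isGLB_csInf hJne hJbdd)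
    have hlim : Tendsto (fun t : J ↦ γ t) atBot (𝓝 (γ b)) := (hcont b hbs).tendsto.comp hcoe
    have hpb : p = γ b := tendsto_nhds_unique hpJ hlim
    exact hγb (hpb ▸ hp)

end Topology

/-! ### Curves in an open sub-spacetime -/

section Opens

variable {E : Type*} [NormedAddCommGroup E] [NormedSpace ℝ E] {H : Type*} [TopologicalSpace H]
  {I : ModelWithCorners ℝ E H} {n : ℕ∞ω} {M : Type*} [TopologicalSpace M] [ChartedSpace H M]
  [IsManifold I ∞ M]

omit [IsManifold I ∞ M] in
/-- A curve into an open submanifold is differentiable iff its composite with the inclusion is.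
[folklore] -/
theorem mdifferentiableAt_subtypeVal_comp_curve_iff (U : Opens M) {γ : ℝ → U} {t : ℝ} :
    MDifferentiableAt 𝓘(ℝ, ℝ) I (Subtype.val ∘ γ) t ↔ MDifferentiableAt 𝓘(ℝ, ℝ) I γ t :=
  ChartedSpace.liftPropWithinAt_subtypeVal_comp_iff (P := DifferentiableWithinAtProp 𝓘(ℝ, ℝ) I)
    γ univ t

omit [IsManifold I ∞ M] in
/-- **The velocity of a curve in an open sub-spacetime is its velocity in the ambient spacetime**
(`d(Subtype.val) = id`, and the two curves are differentiable simultaneously; both velocities are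
the junk value `0` at parameters of non-differentiability). Lee 2013, Prop. 3.9. [folklore] -/
theorem velocity_subtypeVal_comp (U : Opens M) (γ : ℝ → U) (t : ℝ) :
    (velocity I (Subtype.val ∘ γ) t : E) = (velocity I γ t : E) := by
  by_cases hd : MDifferentiableAt 𝓘(ℝ, ℝ) I γ t
  · have h := mfderiv_comp t (hasMFDerivAt_subtypeVal (I' := I) (W := U) (γ t)).mdifferentiableAt hd
    have h1 := DFunLike.congr_fun h (1 : ℝ)
    change mfderiv 𝓘(ℝ, ℝ) I (Subtype.val ∘ γ) t (1 : ℝ) = mfderiv 𝓘(ℝ, ℝ) I γ t (1 : ℝ)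
    refine h1.trans ?_
    change mfderiv I I (Subtype.val : U → M) (γ t) (mfderiv 𝓘(ℝ, ℝ) I γ t (1 : ℝ)) = _
    rw [mfderiv_subtypeVal]
    rfl
  · have hd' : ¬ MDifferentiableAt 𝓘(ℝ, ℝ) I (Subtype.val ∘ γ) t :=
      fun h ↦ hd ((mdifferentiableAt_subtypeVal_comp_curve_iff U).1 h)
    change mfderiv 𝓘(ℝ, ℝ) I (Subtype.val ∘ γ) t (1 : ℝ) = mfderiv 𝓘(ℝ, ℝ) I γ t (1 : ℝ)
    rw [mfderiv_zero_of_not_mdifferentiableAt hd, mfderiv_zero_of_not_mdifferentiableAt hd']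
    rfl

namespace LorentzianMetric

variable (g : LorentzianMetric I n M) (τ : TimeOrientation g)
  (hres : PseudoRiemannianMetric.contMDiff_restrict (I := I) (n := n) (M := M))
  (hτ : τ.contMDiff_restrict) (U : Opens M)

/-- **A curve in an open sub-spacetime is a future timelike curve there iff it is one in the
ambient spacetime** (`T_p U = T_p M`, same metric and time orientation at the point, same
velocity). O'Neill 1983, Ch. 1, pp. 3–7 (open submanifolds); Sbierski 2016, §3.1.
[cite: Sbierski2016AHP, §3.1, proof of the existence of the MCGHD] -/
theorem isFutureTimelikeCurveOn_restrict_iff {γ : ℝ → U} {s : Set ℝ} :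
    (g.restrict hres U).IsFutureTimelikeCurveOn (τ.restrict hres hτ U) γ s ↔
      g.IsFutureTimelikeCurveOn τ (Subtype.val ∘ γ) s := by
  refine forall₂_congr fun t _ ↦ ?_
  have hv := velocity_subtypeVal_comp (I := I) U γ t
  change (MDifferentiableAt 𝓘(ℝ, ℝ) I γ t ∧
      g.val (γ t).1 (velocity I γ t) (velocity I γ t) < 0 ∧
      (g.val (γ t).1 (velocity I γ t) (velocity I γ t) ≤ 0 ∧ (velocity I γ t : E) ≠ 0) ∧
        g.val (γ t).1 (τ.vectorField (γ t).1) (velocity I γ t) < 0) ↔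
    (MDifferentiableAt 𝓘(ℝ, ℝ) I (Subtype.val ∘ γ) t ∧
      g.val (γ t).1 (velocity I (Subtype.val ∘ γ) t) (velocity I (Subtype.val ∘ γ) t) < 0 ∧
      (g.val (γ t).1 (velocity I (Subtype.val ∘ γ) t) (velocity I (Subtype.val ∘ γ) t) ≤ 0 ∧
          (velocity I (Subtype.val ∘ γ) t : E) ≠ 0) ∧
        g.val (γ t).1 (τ.vectorField (γ t).1) (velocity I (Subtype.val ∘ γ) t) < 0)
  rw [mdifferentiableAt_subtypeVal_comp_curve_iff, hv]
  exact Iff.rfl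

/-- An endless timelike curve of the ambient spacetime lying in the open sub-spacetime `U` is an
endless timelike curve of `U`. [cite: Sbierski2016AHP, §3.1, proof of the existence of the MCGHD] -/
theorem IsEndlessTimelikeCurve.restrict_of_subtypeVal_comp {γ : ℝ → U} {s : Set ℝ}
    (h : g.IsEndlessTimelikeCurve τ (Subtype.val ∘ γ) s) :
    (g.restrict hres U).IsEndlessTimelikeCurve (τ.restrict hres hτ U) γ s :=
  ⟨h.1, (isFutureTimelikeCurveOn_restrict_iff g τ hres hτ U).2 h.2.1,
    IsFutureEndless.of_subtypeVal_comp h.2.2.1, IsPastEndless.of_subtypeVal_comp h.2.2.2⟩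

/-! ### A Cauchy hypersurface is met at most once by the timelike curves of any open sub-spacetime -/

variable {g τ U}

/-- **At most one crossing.** If `S` is a Cauchy hypersurface of `(M, g, τ)` (Hausdorff, second
countable, without boundary, finite-dimensional, `C²`) and `γ` is a future timelike curve of the
open sub-spacetime `U` on a parameter interval `s`, then `γ` meets `S` at most once: a timelike
segment of `M` from `S` to `S` extends to an endless timelike curve of `M`
(`exists_isEndlessTimelikeCurve_extends`) meeting `S` twice. O'Neill 1983, Ch. 14, Lemma 14.29
(a Cauchy hypersurface is achronal); Sbierski 2016, §3.1 ("`γ` cannot meet `ι(M̄)` more than once,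
since `γ` is also a segment of an inextendible timelike curve in `M`").
[cite: Sbierski2016AHP, §3.1, proof of the existence of the MCGHD] -/
theorem IsCauchyHypersurface.eq_of_mem_of_mem_opens [T2Space M] [SecondCountableTopology M]
    [BoundarylessManifold I M] [FiniteDimensional ℝ E] (hn : 2 ≤ n) {S : Set M}
    (hS : g.IsCauchyHypersurface τ S) {γ : ℝ → U} {s : Set ℝ} (hs : s.OrdConnected)
    (hγ : (g.restrict hres U).IsFutureTimelikeCurveOn (τ.restrict hres hτ U) γ s) {t₁ t₂ : ℝ}
    (ht₁ : t₁ ∈ s) (ht₂ : t₂ ∈ s) (h₁ : (γ t₁ : M) ∈ S) (h₂ : (γ t₂ : M) ∈ S) : t₁ = t₂ := by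
  have hγ' := (isFutureTimelikeCurveOn_restrict_iff g τ hres hτ U).1 hγ
  by_contra hne
  wlog hlt : t₁ < t₂ generalizing t₁ t₂
  · exact this ht₂ ht₁ h₂ h₁ (Ne.symm hne) (lt_of_le_of_ne (not_lt.1 hlt) (Ne.symm hne))
  obtain ⟨Δ, D, hΔ, h₁D, h₂D, hΔ₁, hΔ₂⟩ :=
    exists_isEndlessTimelikeCurve_extends hn hlt (hγ'.mono (hs.out ht₁ ht₂))
  obtain ⟨t, -, huniq⟩ := hS Δ D hΔ
  have e₁ := huniq t₁ ⟨h₁D, by rw [hΔ₁]; exact h₁⟩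
  have e₂ := huniq t₂ ⟨h₂D, by rw [hΔ₂]; exact h₂⟩
  exact hne (e₁.trans e₂.symm)

/-! ### A Cauchy hypersurface of each member of an open cover is a Cauchy hypersurface of the union -/

/-- **A common Cauchy hypersurface of open sub-spacetimes is a Cauchy hypersurface of their
union.** Let `S` be a Cauchy hypersurface of `(M, g, τ)` and `V i ⊆ M` open sub-spacetimes such
that `S ∩ V i` is a Cauchy hypersurface of each `(V i, g|_{V i}, τ|_{V i})`. Then `S ∩ ⋃ V i` is a
Cauchy hypersurface of the union `⋃ V i`. *"Let `γ` be an inextendible timelike curve in `U`.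
Take a point on `γ`; it lies in some `U_α` and the corresponding curve segment in `U_α` can be
considered to be an inextendible timelike curve in `U_α` and thus has to meet `ι(M̄)`. Note that
`γ` cannot meet `ι(M̄)` more than once, since `γ` is also a segment of an inextendible timelike
curve in `M`"* (Sbierski 2016, §3.1, proof of the existence of the MCGHD, second bullet). The
"corresponding curve segment" is the connected piece of `γ` through the chosen point inside
`V i` (`not_hasFutureEndpoint_connectedComponentIn` and its time dual supply its endlessness).
[cite: Sbierski2016AHP, §3.1, proof of the existence of the MCGHD] -/
theorem IsCauchyHypersurface.iSup_opens [T2Space M] [SecondCountableTopology M]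
    [BoundarylessManifold I M] [FiniteDimensional ℝ E] (hn : 2 ≤ n) {S : Set M}
    (hS : g.IsCauchyHypersurface τ S) {ι' : Type*} (V : ι' → Opens M)
    (hV : ∀ i, (g.restrict hres (V i)).IsCauchyHypersurface (τ.restrict hres hτ (V i))
      (Subtype.val ⁻¹' S)) :
    (g.restrict hres (⨆ i, V i)).IsCauchyHypersurface (τ.restrict hres hτ (⨆ i, V i))
      (Subtype.val ⁻¹' S) := by
  classical
  intro γ s hγ
  obtain ⟨hs, hγt, hγf, hγp⟩ := hγ
  obtain ⟨t₀, ht₀⟩ := hγf.1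
  -- the chosen point lies in some `V i`
  obtain ⟨i, hi⟩ : ∃ i, (γ t₀ : M) ∈ V i := Opens.mem_iSup.1 (γ t₀).2
  -- the ambient curve and its continuity on `s`
  have hγM : g.IsFutureTimelikeCurveOn τ (Subtype.val ∘ γ) s :=
    (isFutureTimelikeCurveOn_restrict_iff g τ hres hτ _).1 hγt
  have hcontW : ∀ t ∈ s, ContinuousAt γ t := fun t ht ↦ (hγt t ht).1.continuousAt
  have hcontM : ∀ t ∈ s, ContinuousAt (Subtype.val ∘ γ) t := fun t ht ↦ (hγM t ht).1.continuousAt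
  -- the connected piece of `γ` through `t₀` inside `V i`
  set O : Set (⨆ i, V i : Opens M) := Subtype.val ⁻¹' (V i : Set M) with hO
  have hOo : IsOpen O := (V i).2.preimage continuous_subtype_val
  set J := connectedComponentIn (s ∩ γ ⁻¹' O) t₀ with hJ
  have ht₀J : t₀ ∈ J := mem_connectedComponentIn ⟨ht₀, hi⟩
  have hJsub : J ⊆ s ∩ γ ⁻¹' O := connectedComponentIn_subset _ _
  have hJord : J.OrdConnected :=
    isPreconnected_iff_ordConnected.1 isPreconnected_connectedComponentIn
  -- the piece, as a curve of `V i`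
  set δ : ℝ → V i := fun t ↦ if h : (γ t : M) ∈ V i then ⟨γ t, h⟩ else ⟨γ t₀, hi⟩ with hδ
  have hδval : ∀ t ∈ J, (δ t : M) = γ t := fun t ht ↦ by
    have hmem : (γ t : M) ∈ V i := (hJsub ht).2
    show Subtype.val (if h : (γ t : M) ∈ V i then (⟨γ t, h⟩ : V i) else (⟨γ t₀, hi⟩ : V i)) = γ t
    rw [dif_pos hmem]
  have hδev : ∀ t ∈ J, (Subtype.val ∘ δ) =ᶠ[𝓝 t] (Subtype.val ∘ γ) := fun t ht ↦ by
    have hmem : γ ⁻¹' O ∈ 𝓝 t := (hcontW t (hJsub ht).1).preimage_mem_nhds (hOo.mem_nhds (hJsub ht).2)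
    filter_upwards [hmem] with t' ht'
    simp only [comp_apply, hδ, dif_pos (show (γ t' : M) ∈ V i from ht')]
  -- `δ` is a future timelike curve of `V i` on `J`
  have hδt : (g.restrict hres (V i)).IsFutureTimelikeCurveOn (τ.restrict hres hτ (V i)) δ J := by
    rw [isFutureTimelikeCurveOn_restrict_iff]
    intro t ht
    obtain ⟨hd, h1, h2⟩ := hγM t (hJsub ht).1
    have hveq : velocity I (Subtype.val ∘ δ) t = velocity I (Subtype.val ∘ γ) t :=
      DFunLike.congr_fun (hδev t ht).mfderiv_eq (1 : ℝ)
    refine ⟨(hδev t ht).mdifferentiableAt_iff.2 hd, ?_, ?_⟩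
    · change g.val (δ t : M) (velocity I (Subtype.val ∘ δ) t) (velocity I (Subtype.val ∘ δ) t) < 0
      rw [hveq, hδval t ht]
      exact h1
    · change (g.val (δ t : M) (velocity I (Subtype.val ∘ δ) t)
          (velocity I (Subtype.val ∘ δ) t) ≤ 0 ∧ velocity I (Subtype.val ∘ δ) t ≠ 0) ∧
        g.val (δ t : M) (τ.vectorField (δ t : M)) (velocity I (Subtype.val ∘ δ) t) < 0
      rw [hveq, hδval t ht]
      exact h2
  -- `δ` is endless on `J` (in `V i`)
  have hδf : IsFutureEndless δ J := by
    refine ⟨⟨t₀, ht₀J⟩, fun q hq ↦ ?_⟩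
    have h1 : HasFutureEndpoint (Subtype.val ∘ δ) J (q : M) :=
      hasFutureEndpoint_subtypeVal_comp_iff.2 hq
    have h2 : HasFutureEndpoint (Subtype.val ∘ γ) J (q : M) := by
      refine h1.congr fun t ↦ ?_
      exact hδval t t.2
    have h3 : HasFutureEndpoint γ J ⟨q, Opens.mem_iSup.2 ⟨i, q.2⟩⟩ :=
      hasFutureEndpoint_subtypeVal_comp_iff.1 h2
    exact not_hasFutureEndpoint_connectedComponentIn hs hcontW hγf hOo ht₀ hi
      (p := ⟨q, Opens.mem_iSup.2 ⟨i, q.2⟩⟩) q.2 h3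
  have hδp : IsPastEndless δ J := by
    refine ⟨⟨t₀, ht₀J⟩, fun q hq ↦ ?_⟩
    have h1 : HasPastEndpoint (Subtype.val ∘ δ) J (q : M) :=
      hasPastEndpoint_subtypeVal_comp_iff.2 hq
    have h2 : HasPastEndpoint (Subtype.val ∘ γ) J (q : M) := by
      refine h1.congr fun t ↦ ?_
      exact hδval t t.2
    have h3 : HasPastEndpoint γ J ⟨q, Opens.mem_iSup.2 ⟨i, q.2⟩⟩ :=
      hasPastEndpoint_subtypeVal_comp_iff.1 h2
    exact not_hasPastEndpoint_connectedComponentIn hs hcontW hγp hOo ht₀ hi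
      (p := ⟨q, Opens.mem_iSup.2 ⟨i, q.2⟩⟩) q.2 h3
  -- hence `δ` meets `S`: existence of a crossing of `γ`
  obtain ⟨t₁, ⟨ht₁J, ht₁S⟩, -⟩ := hV i δ J ⟨hJord, hδt, hδf, hδp⟩
  have hγt₁ : (γ t₁ : M) ∈ S := by rw [← hδval t₁ ht₁J]; exact ht₁S
  refine ⟨t₁, ⟨(hJsub ht₁J).1, hγt₁⟩, fun t₂ ht₂ ↦ ?_⟩
  -- uniqueness of the crossing: at most once in `M`
  exact IsCauchyHypersurface.eq_of_mem_of_mem_opens hres hτ hn hS hs hγt ht₂.1 (hJsub ht₁J).1 ht₂.2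
    hγt₁

end LorentzianMetric

end Opens

end Literature.Geometry.Lorentzian

end
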